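import Summits.FinalStateConjecture.FinalStateConjecture.Theorems.SwallowTheDatumParametricKerrBurialStubEndRescaling
import Mathlib.Analysis.Calculus.MeanValue
import Mathlib.Analysis.InnerProductSpace.Calculus
import HarnessLib

/-!
# Stub `stub_clusterFarField` of the line `Sketch` (crux `SwallowTheDatum.UniversalWitnessFamily`,
# item stmt-FinalStateConjecture-10051): the far field of a balanced cluster of punctures

Toolkit lemma T1 of the Brill–Lindquist bulk `ψ = A + Σ_j α_j/‖y − c_j‖` (punctures `c_j` with
`‖c_j‖ ≤ d`, positive weights `α_j`, vanishing dipole moment `Σ_j α_j c_j = 0`).  Far from the cluster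
(`‖y‖ ≥ 4d`) the bulk is the monopole `(Σ_j α_j)/‖y‖` plus a remainder of QUADRUPOLE order, with two
derivatives:

  `‖D^m (Σ_j α_j/‖· − c_j‖ − (Σ_j α_j)/‖·‖)(y)‖ ≤ K (Σ_j α_j) d²/‖y‖^{m+3}`,  `m ≤ 2`,

uniformly in the number of punctures and linearly in the weights (`stub_clusterFarField`, §3).

* §1 The Newtonian potential `y ↦ ‖y‖⁻¹` on `ℝ³ ∖ {0}`: smoothness, and the radial estimate
  `‖D^k (‖·‖⁻¹)(z)‖ ≤ C_k/‖z‖^{k+1}` proved WITHOUT computing a derivative — by homogeneity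
  (`‖R • y‖⁻¹ = R⁻¹ ‖y‖⁻¹`, chain rule under the homothety `y ↦ R • y`: the landed
  `ParametricKerrBurial.norm_iteratedFDeriv_comp_smul_le` of `…StubEndRescaling.lean`) and compactness of the
  unit sphere
  (`exists_bound_sphere_invNorm`, `exists_radialBound_invNorm`).
* §2 The second-order Taylor remainder of `u ↦ D^m (‖·‖⁻¹)(y − u)` at `u = 0`, by the mean value
  inequality applied twice (`Convex.norm_image_sub_le_of_norm_fderiv_le`, `…_le'`) on the ball
  `closedBall y d`, where `‖w‖ ≥ ‖y‖/2` (`norm_taylorRemainder_invNorm_le`).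
* §3 The stub: by linearity of `iteratedFDeriv` the weighted dipole terms
  `Σ_j α_j D(D^m ‖·‖⁻¹)(y)(c_j)` may be inserted for free (they sum to
  `D(D^m ‖·‖⁻¹)(y)(Σ_j α_j c_j) = 0`), after which each puncture contributes a Taylor remainder
  `≤ 2^{m+3} C d ‖c_j‖/‖y‖^{m+3}`.

References: Brill–Lindquist 1963 (the bulk); the estimate itself is the elementary multipole expansion of
the Newtonian potential (folklore).  No derivative of `‖y‖⁻¹` is ever written down.
-/

-- `Summit.<Summit>.<Problem>` is the tree's mandated summit-side namespace (CONVENTIONS §2); for this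
-- single-conjunct summit the two coincide, so the duplicate is deliberate.
set_option linter.dupNamespace false

noncomputable section

namespace Summit.FinalStateConjecture.FinalStateConjecture.Theorems.SwallowTheDatum.UniversalWitnessFamily

open scoped ContDiff Topology BigOperators InnerProductSpace
open Set Filter Function Metric Literature.Geometry.Lorentzian
open Summit.FinalStateConjecture.FinalStateConjecture.Theorems.SwallowTheDatum.ParametricKerrBurial
  (norm_iteratedFDeriv_comp_smul_le)

/-! ## §1 The Newtonian potential `y ↦ ‖y‖⁻¹` away from the origin -/

/-- The Newtonian potential `y ↦ ‖y‖⁻¹` is smooth away from the origin. [folklore] -/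
theorem contDiffAt_invNorm {z : E3} (hz : z ≠ 0) {n : WithTop ℕ∞} :
    ContDiffAt ℝ n (fun w : E3 ↦ ‖w‖⁻¹) z :=
  (contDiffAt_norm ℝ hz).fun_inv (norm_ne_zero_iff.2 hz)

/-- The translated potential `w ↦ ‖w − a‖⁻¹` is smooth away from `a`. [folklore] -/
theorem contDiffAt_invNorm_sub {z a : E3} (hz : z - a ≠ 0) {n : WithTop ℕ∞} :
    ContDiffAt ℝ n (fun w : E3 ↦ ‖w - a‖⁻¹) z := by
  have h1 : ContDiffAt ℝ n (fun w : E3 ↦ w - a) z := contDiffAt_id.sub contDiffAt_const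
  exact (contDiffAt_invNorm hz).comp (g := fun w : E3 ↦ ‖w‖⁻¹) (f := fun w : E3 ↦ w - a) z h1

/-- The iterated derivatives of the Newtonian potential are differentiable away from the origin.
[folklore] -/
theorem differentiableAt_iteratedFDeriv_invNorm (k : ℕ) {z : E3} (hz : z ≠ 0) :
    DifferentiableAt ℝ (iteratedFDeriv ℝ k (fun w : E3 ↦ ‖w‖⁻¹)) z :=
  (contDiffAt_invNorm hz (n := (k + 1 : ℕ))).differentiableAt_iteratedFDeriv
    (by exact_mod_cast Nat.lt_succ_self k)

/-- Translation invariance: `D^m (‖· − a‖⁻¹)(y) = D^m (‖·‖⁻¹)(y − a)`. [folklore] -/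
theorem iteratedFDeriv_invNorm_sub (m : ℕ) (a y : E3) :
    iteratedFDeriv ℝ m (fun w : E3 ↦ ‖w - a‖⁻¹) y =
      iteratedFDeriv ℝ m (fun w : E3 ↦ ‖w‖⁻¹) (y - a) :=
  iteratedFDeriv_comp_sub (f := fun w : E3 ↦ ‖w‖⁻¹) m a y

/-- **Homogeneity of the Newtonian potential**: for `z ≠ 0`,
`‖D^k (‖·‖⁻¹)(z)‖ ≤ ‖z‖^{-(k+1)} ‖D^k (‖·‖⁻¹)(z/‖z‖)‖` (`‖(‖z‖ • w)‖⁻¹ = ‖z‖⁻¹ ‖w‖⁻¹` and the scaling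
of iterated derivatives under the homothety `w ↦ ‖z‖⁻¹ • w`, `norm_iteratedFDeriv_comp_smul_le`). [folklore] -/
theorem norm_iteratedFDeriv_invNorm_le_sphere (k : ℕ) {z : E3} (hz : z ≠ 0) :
    ‖iteratedFDeriv ℝ k (fun w : E3 ↦ ‖w‖⁻¹) z‖ ≤
      (‖z‖ ^ (k + 1))⁻¹ * ‖iteratedFDeriv ℝ k (fun w : E3 ↦ ‖w‖⁻¹) (‖z‖⁻¹ • z)‖ := by
  have hR : 0 < ‖z‖ := norm_pos_iff.2 hz
  have hx : ‖z‖⁻¹ • z ≠ 0 := smul_ne_zero (inv_ne_zero hR.ne') hz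
  have key := norm_iteratedFDeriv_comp_smul_le (fun w : E3 ↦ ‖‖z‖ • w‖⁻¹) (inv_pos.2 hR) k z
  simp only [smul_inv_smul₀ hR.ne'] at key
  have e2 : (fun w : E3 ↦ ‖‖z‖ • w‖⁻¹) = ‖z‖⁻¹ • fun w : E3 ↦ ‖w‖⁻¹ := by
    funext w
    rw [Pi.smul_apply, norm_smul, Real.norm_of_nonneg hR.le, mul_inv, smul_eq_mul]
  rw [e2, iteratedFDeriv_const_smul_apply (contDiffAt_invNorm hx), norm_smul, norm_inv,
    norm_norm] at key
  calc ‖iteratedFDeriv ℝ k (fun w : E3 ↦ ‖w‖⁻¹) z‖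
      ≤ ‖z‖⁻¹ ^ k * (‖z‖⁻¹ * ‖iteratedFDeriv ℝ k (fun w : E3 ↦ ‖w‖⁻¹) (‖z‖⁻¹ • z)‖) := key
    _ = (‖z‖ ^ (k + 1))⁻¹ * ‖iteratedFDeriv ℝ k (fun w : E3 ↦ ‖w‖⁻¹) (‖z‖⁻¹ • z)‖ := by
      rw [← mul_assoc, ← pow_succ, inv_pow]

/-- The iterated derivatives of the Newtonian potential are bounded on the unit sphere (continuity on
the compact sphere). [folklore] -/
theorem exists_bound_sphere_invNorm (k : ℕ) :
    ∃ C : ℝ, 0 ≤ C ∧ ∀ x : E3, ‖x‖ = 1 → ‖iteratedFDeriv ℝ k (fun w : E3 ↦ ‖w‖⁻¹) x‖ ≤ C := by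
  have hc : ContinuousOn (iteratedFDeriv ℝ k (fun w : E3 ↦ ‖w‖⁻¹)) (sphere (0 : E3) 1) := by
    refine fun x hx ↦ ContinuousAt.continuousWithinAt ?_
    have hx0 : x ≠ 0 := by
      rw [mem_sphere_zero_iff_norm] at hx
      rw [← norm_ne_zero_iff, hx]
      exact one_ne_zero
    exact ((contDiffAt_invNorm hx0 (n := (k : ℕ))).iteratedFDeriv_right (m := 0) (i := k)
      (by simp)).continuousAt
  obtain ⟨C, hC⟩ := (isCompact_sphere (0 : E3) 1).exists_bound_of_continuousOn hc
  exact ⟨max C 0, le_max_right _ _,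
    fun x hx ↦ (hC x (mem_sphere_zero_iff_norm.2 hx)).trans (le_max_left _ _)⟩

/-- **Radial estimate** `‖D^k (‖·‖⁻¹)(z)‖ ≤ C_k/‖z‖^{k+1}` on `ℝ³ ∖ {0}` (homogeneity and compactness;
no derivative is computed). [folklore] -/
theorem exists_radialBound_invNorm (k : ℕ) :
    ∃ C : ℝ, 0 ≤ C ∧ ∀ z : E3, z ≠ 0 →
      ‖iteratedFDeriv ℝ k (fun w : E3 ↦ ‖w‖⁻¹) z‖ ≤ C / ‖z‖ ^ (k + 1) := by
  obtain ⟨C, hC0, hC⟩ := exists_bound_sphere_invNorm k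
  refine ⟨C, hC0, fun z hz ↦ ?_⟩
  have hR : 0 < ‖z‖ := norm_pos_iff.2 hz
  have h1 : ‖‖z‖⁻¹ • z‖ = 1 := by
    rw [norm_smul, norm_inv, norm_norm, inv_mul_cancel₀ hR.ne']
  calc ‖iteratedFDeriv ℝ k (fun w : E3 ↦ ‖w‖⁻¹) z‖
      ≤ (‖z‖ ^ (k + 1))⁻¹ * ‖iteratedFDeriv ℝ k (fun w : E3 ↦ ‖w‖⁻¹) (‖z‖⁻¹ • z)‖ :=
        norm_iteratedFDeriv_invNorm_le_sphere k hz
    _ ≤ (‖z‖ ^ (k + 1))⁻¹ * C :=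
        mul_le_mul_of_nonneg_left (hC _ h1) (inv_nonneg.2 (pow_nonneg hR.le _))
    _ = C / ‖z‖ ^ (k + 1) := by rw [div_eq_mul_inv, mul_comm]

/-! ## §2 The second-order Taylor remainder of `u ↦ D^m (‖·‖⁻¹)(y − u)` -/

/-- **Taylor remainder of the translated potential.** If `‖D^{m+2} (‖·‖⁻¹)(z)‖ ≤ C/‖z‖^{m+3}` on
`ℝ³ ∖ {0}`, then for `y ≠ 0`, `4d ≤ ‖y‖` and `‖u‖ ≤ d`,
`‖D^m(‖·‖⁻¹)(y − u) − D^m(‖·‖⁻¹)(y) − D(D^m ‖·‖⁻¹)(y)(−u)‖ ≤ 2^{m+3} C d²/‖y‖^{m+3}`: the mean value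
inequality twice on the ball `closedBall y d ⊆ {‖w‖ ≥ ‖y‖/2}`. [folklore] -/
theorem norm_taylorRemainder_invNorm_le {m : ℕ} {C : ℝ} (hC0 : 0 ≤ C)
    (hC : ∀ z : E3, z ≠ 0 →
      ‖iteratedFDeriv ℝ (m + 2) (fun w : E3 ↦ ‖w‖⁻¹) z‖ ≤ C / ‖z‖ ^ (m + 3))
    {y u : E3} {d : ℝ} (hy : y ≠ 0) (hd : 4 * d ≤ ‖y‖) (hu : ‖u‖ ≤ d) :
    ‖iteratedFDeriv ℝ m (fun w : E3 ↦ ‖w‖⁻¹) (y - u) - iteratedFDeriv ℝ m (fun w : E3 ↦ ‖w‖⁻¹) y -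
        fderiv ℝ (iteratedFDeriv ℝ m (fun w : E3 ↦ ‖w‖⁻¹)) y (y - u - y)‖ ≤
      2 ^ (m + 3) * C * d ^ 2 / ‖y‖ ^ (m + 3) := by
  have hd0 : 0 ≤ d := (norm_nonneg u).trans hu
  have hy0 : 0 < ‖y‖ := norm_pos_iff.2 hy
  -- on the ball the norm stays comparable to `‖y‖`
  have hfar : ∀ w ∈ closedBall y d, ‖y‖ / 2 ≤ ‖w‖ := fun w hw ↦ by
    rw [mem_closedBall, dist_eq_norm] at hw
    have h1 : ‖y‖ - ‖w‖ ≤ ‖w - y‖ := by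
      rw [norm_sub_rev]
      exact norm_sub_norm_le y w
    linarith
  have hne : ∀ w ∈ closedBall y d, w ≠ 0 := fun w hw ↦
    norm_pos_iff.1 (lt_of_lt_of_le (by linarith) (hfar w hw))
  -- the bound on the second derivative of `D^m (‖·‖⁻¹)` on the ball
  obtain ⟨M, hM⟩ : ∃ M : ℝ, M = 2 ^ (m + 3) * C / ‖y‖ ^ (m + 3) := ⟨_, rfl⟩
  have hM0 : 0 ≤ M := by
    rw [hM]
    positivity
  have hD2 : ∀ w ∈ closedBall y d,
      ‖fderiv ℝ (iteratedFDeriv ℝ (m + 1) (fun w : E3 ↦ ‖w‖⁻¹)) w‖ ≤ M := by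
    intro w hw
    rw [norm_fderiv_iteratedFDeriv]
    have hw0 : 0 < ‖w‖ := norm_pos_iff.2 (hne w hw)
    calc ‖iteratedFDeriv ℝ (m + 2) (fun w : E3 ↦ ‖w‖⁻¹) w‖ ≤ C / ‖w‖ ^ (m + 3) := hC w (hne w hw)
      _ ≤ C / (‖y‖ / 2) ^ (m + 3) :=
          div_le_div_of_nonneg_left hC0 (by positivity)
            (pow_le_pow_left₀ (by positivity) (hfar w hw) _)
      _ = M := by
          rw [hM, div_pow, div_div_eq_mul_div]
          ring
  -- first mean value inequality: `D(D^m ‖·‖⁻¹)` is `M`-Lipschitz on the ball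
  have hLip : ∀ w ∈ closedBall y d,
      ‖fderiv ℝ (iteratedFDeriv ℝ m (fun w : E3 ↦ ‖w‖⁻¹)) w -
        fderiv ℝ (iteratedFDeriv ℝ m (fun w : E3 ↦ ‖w‖⁻¹)) y‖ ≤ M * d := by
    intro w hw
    have h := (convex_closedBall y d).norm_image_sub_le_of_norm_fderiv_le
      (f := iteratedFDeriv ℝ (m + 1) (fun w : E3 ↦ ‖w‖⁻¹))
      (fun w hw ↦ differentiableAt_iteratedFDeriv_invNorm (m + 1) (hne w hw)) hD2
      (mem_closedBall_self hd0) hw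
    rw [fderiv_iteratedFDeriv, comp_apply, comp_apply, ← LinearIsometryEquiv.map_sub,
      LinearIsometryEquiv.norm_map]
    refine h.trans (mul_le_mul_of_nonneg_left ?_ hM0)
    rwa [mem_closedBall, dist_eq_norm] at hw
  -- second mean value inequality
  have hyu : y - u ∈ closedBall y d := by
    rw [mem_closedBall, dist_eq_norm, sub_sub_cancel_left, norm_neg]
    exact hu
  have h := (convex_closedBall y d).norm_image_sub_le_of_norm_fderiv_le'
    (f := iteratedFDeriv ℝ m (fun w : E3 ↦ ‖w‖⁻¹))
    (fun w hw ↦ differentiableAt_iteratedFDeriv_invNorm m (hne w hw)) hLip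
    (mem_closedBall_self hd0) hyu
  refine h.trans ?_
  rw [sub_sub_cancel_left, norm_neg]
  calc M * d * ‖u‖ ≤ M * d * d := mul_le_mul_of_nonneg_left hu (mul_nonneg hM0 hd0)
    _ = 2 ^ (m + 3) * C * d ^ 2 / ‖y‖ ^ (m + 3) := by
        rw [hM]
        ring

/-! ## §3 The stub -/

/-- **Stub `stub_clusterFarField`** (registered signature; toolkit T1 of `stub_bulkAt`, line `Sketch`,
crux item stmt-FinalStateConjecture-10051). Far from a cluster of punctures `c_j` (`‖c_j‖ ≤ d`, weights
`α_j > 0`) with vanishing dipole moment `Σ_j α_j c_j = 0`, the Brill–Lindquist potential is the monopole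
`(Σ_j α_j)/‖y‖` up to a quadrupole-order remainder:
`‖D^m(Σ_j α_j/‖· − c_j‖ − (Σ_j α_j)/‖·‖)(y)‖ ≤ K (Σ_j α_j) d²/‖y‖^{m+3}` for `m ≤ 2`, `‖y‖ ≥ 4d`,
`y ≠ 0`, with an absolute constant `K`.  Proof: linearity of `iteratedFDeriv`, insertion of the dipole
terms `Σ_j α_j D(D^m ‖·‖⁻¹)(y)(c_j) = D(D^m ‖·‖⁻¹)(y)(Σ_j α_j c_j) = 0`, and the Taylor remainder
`norm_taylorRemainder_invNorm_le` fed with the radial estimate `exists_radialBound_invNorm` at orders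
`2, 3, 4`. [folklore] -/
theorem stub_clusterFarField :
    ∃ K : ℝ, 0 < K ∧ ∀ (N : ℕ) (c : Fin (N + 1) → E3) (α : Fin (N + 1) → ℝ) (d : ℝ),
      (∀ j, 0 < α j) → 0 ≤ d → (∀ j, ‖c j‖ ≤ d) → ∑ j, α j • c j = 0 →
      ∀ y : E3, 4 * d ≤ ‖y‖ → y ≠ 0 → ∀ m : ℕ, m ≤ 2 →
        ‖iteratedFDeriv ℝ m (fun z : E3 ↦ ∑ j, α j / ‖z - c j‖ - (∑ j, α j) / ‖z‖) y‖ ≤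
          K * (∑ j, α j) * d ^ 2 / ‖y‖ ^ (m + 3) := by
  -- one constant for the radial estimates at orders `m + 2`, `m ≤ 2`
  obtain ⟨C, hC0, hC⟩ : ∃ C : ℝ, 0 ≤ C ∧ ∀ m : ℕ, m ≤ 2 → ∀ z : E3, z ≠ 0 →
      ‖iteratedFDeriv ℝ (m + 2) (fun w : E3 ↦ ‖w‖⁻¹) z‖ ≤ C / ‖z‖ ^ (m + 3) := by
    obtain ⟨C₂, h₂, hC₂⟩ := exists_radialBound_invNorm 2
    obtain ⟨C₃, h₃, hC₃⟩ := exists_radialBound_invNorm 3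
    obtain ⟨C₄, h₄, hC₄⟩ := exists_radialBound_invNorm 4
    refine ⟨C₂ + C₃ + C₄, by positivity, fun m hm z hz ↦ ?_⟩
    have hP : 0 < ‖z‖ ^ (m + 3) := pow_pos (norm_pos_iff.2 hz) _
    interval_cases m
    · exact (hC₂ z hz).trans (div_le_div_of_nonneg_right (by linarith) hP.le)
    · exact (hC₃ z hz).trans (div_le_div_of_nonneg_right (by linarith) hP.le)
    · exact (hC₄ z hz).trans (div_le_div_of_nonneg_right (by linarith) hP.le)
  refine ⟨2 ^ 5 * C + 1, by positivity, ?_⟩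
  intro N c α d hα hd hc hαc y hy hy0 m hm
  have hypos : 0 < ‖y‖ := norm_pos_iff.2 hy0
  -- no puncture sits at `y`
  have hcy : ∀ j, y - c j ≠ 0 := fun j h ↦ by
    have h' : ‖y‖ ≤ d := by
      rw [sub_eq_zero.1 h]
      exact hc j
    linarith
  -- the weighted summands `F j = α_j (‖· − c_j‖⁻¹ − ‖·‖⁻¹)`
  obtain ⟨F, hF⟩ : ∃ F : Fin (N + 1) → E3 → ℝ,
      ∀ j, F j = fun w ↦ α j • (‖w - c j‖⁻¹ - ‖w‖⁻¹) := ⟨_, fun j ↦ rfl⟩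
  have hfun : (fun z : E3 ↦ ∑ j, α j / ‖z - c j‖ - (∑ j, α j) / ‖z‖) = fun z ↦ ∑ j, F j z := by
    funext z
    simp only [hF, smul_eq_mul, Finset.sum_mul, div_eq_mul_inv, mul_sub, Finset.sum_sub_distrib]
  have hg : ContDiffAt ℝ m (fun w : E3 ↦ ‖w‖⁻¹) y := contDiffAt_invNorm hy0
  have hFj : ∀ j, ContDiffAt ℝ m (fun w : E3 ↦ ‖w - c j‖⁻¹) y := fun j ↦
    contDiffAt_invNorm_sub (hcy j)
  have hsm : ∀ j ∈ Finset.univ, ContDiffAt ℝ m (F j) y := fun j _ ↦ by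
    rw [hF j]
    exact ((hFj j).sub hg).const_smul (α j)
  have hterm : ∀ j, iteratedFDeriv ℝ m (F j) y =
      α j • (iteratedFDeriv ℝ m (fun w : E3 ↦ ‖w‖⁻¹) (y - c j) -
        iteratedFDeriv ℝ m (fun w : E3 ↦ ‖w‖⁻¹) y) := fun j ↦ by
    rw [hF j, iteratedFDeriv_const_smul_apply' ((hFj j).sub hg),
      fun_iteratedFDeriv_sub_apply (hFj j) hg, iteratedFDeriv_invNorm_sub]
  rw [hfun, iteratedFDeriv_fun_sum_apply hsm, Finset.sum_congr rfl fun j _ ↦ hterm j]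
  -- insert the dipole terms, which sum to zero by `Σ_j α_j c_j = 0`
  have hlin : ∑ j, α j • fderiv ℝ (iteratedFDeriv ℝ m (fun w : E3 ↦ ‖w‖⁻¹)) y (y - c j - y) = 0 := by
    have h1 : ∀ j, α j • fderiv ℝ (iteratedFDeriv ℝ m (fun w : E3 ↦ ‖w‖⁻¹)) y (y - c j - y) =
        -(fderiv ℝ (iteratedFDeriv ℝ m (fun w : E3 ↦ ‖w‖⁻¹)) y (α j • c j)) := fun j ↦ by
      rw [sub_sub_cancel_left, map_neg, smul_neg, ← map_smul]
    simp_rw [h1]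
    rw [Finset.sum_neg_distrib, ← map_sum, hαc, map_zero, neg_zero]
  have hdip : ∑ j, α j • (iteratedFDeriv ℝ m (fun w : E3 ↦ ‖w‖⁻¹) (y - c j) -
        iteratedFDeriv ℝ m (fun w : E3 ↦ ‖w‖⁻¹) y) =
      ∑ j, α j • (iteratedFDeriv ℝ m (fun w : E3 ↦ ‖w‖⁻¹) (y - c j) -
        iteratedFDeriv ℝ m (fun w : E3 ↦ ‖w‖⁻¹) y -
        fderiv ℝ (iteratedFDeriv ℝ m (fun w : E3 ↦ ‖w‖⁻¹)) y (y - c j - y)) := by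
    simp only [smul_sub, Finset.sum_sub_distrib, hlin, sub_zero]
  rw [hdip]
  -- the Taylor remainders, puncture by puncture
  have hrem : ∀ j, ‖iteratedFDeriv ℝ m (fun w : E3 ↦ ‖w‖⁻¹) (y - c j) -
      iteratedFDeriv ℝ m (fun w : E3 ↦ ‖w‖⁻¹) y -
      fderiv ℝ (iteratedFDeriv ℝ m (fun w : E3 ↦ ‖w‖⁻¹)) y (y - c j - y)‖ ≤
        2 ^ (m + 3) * C * d ^ 2 / ‖y‖ ^ (m + 3) :=
    fun j ↦ norm_taylorRemainder_invNorm_le hC0 (hC m hm) hy0 hy (hc j)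
  have hS : 0 ≤ ∑ j, α j := Finset.sum_nonneg fun j _ ↦ (hα j).le
  have hQ : 0 ≤ (∑ j, α j) * d ^ 2 / ‖y‖ ^ (m + 3) :=
    div_nonneg (mul_nonneg hS (sq_nonneg d)) (pow_nonneg (norm_nonneg y) _)
  have h25 : (2 : ℝ) ^ (m + 3) * C ≤ 2 ^ 5 * C + 1 := by
    have h2 : (2 : ℝ) ^ (m + 3) ≤ 2 ^ 5 := pow_le_pow_right₀ one_le_two (by omega)
    nlinarith [mul_le_mul_of_nonneg_right h2 hC0]
  calc ‖∑ j, α j • (iteratedFDeriv ℝ m (fun w : E3 ↦ ‖w‖⁻¹) (y - c j) -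
          iteratedFDeriv ℝ m (fun w : E3 ↦ ‖w‖⁻¹) y -
          fderiv ℝ (iteratedFDeriv ℝ m (fun w : E3 ↦ ‖w‖⁻¹)) y (y - c j - y))‖
      ≤ ∑ j, ‖α j • (iteratedFDeriv ℝ m (fun w : E3 ↦ ‖w‖⁻¹) (y - c j) -
          iteratedFDeriv ℝ m (fun w : E3 ↦ ‖w‖⁻¹) y -
          fderiv ℝ (iteratedFDeriv ℝ m (fun w : E3 ↦ ‖w‖⁻¹)) y (y - c j - y))‖ := norm_sum_le _ _
    _ ≤ ∑ j, α j * (2 ^ (m + 3) * C * d ^ 2 / ‖y‖ ^ (m + 3)) := by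
        refine Finset.sum_le_sum fun j _ ↦ ?_
        rw [norm_smul, Real.norm_of_nonneg (hα j).le]
        exact mul_le_mul_of_nonneg_left (hrem j) (hα j).le
    _ = 2 ^ (m + 3) * C * ((∑ j, α j) * d ^ 2 / ‖y‖ ^ (m + 3)) := by
        rw [← Finset.sum_mul]
        ring
    _ ≤ (2 ^ 5 * C + 1) * ((∑ j, α j) * d ^ 2 / ‖y‖ ^ (m + 3)) :=
        mul_le_mul_of_nonneg_right h25 hQ
    _ = (2 ^ 5 * C + 1) * (∑ j, α j) * d ^ 2 / ‖y‖ ^ (m + 3) := by ring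

end Summit.FinalStateConjecture.FinalStateConjecture.Theorems.SwallowTheDatum.UniversalWitnessFamily

end
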